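import Summits.Ventures.HSemireg.WedgeCarrierBridge

/-!
# Venture HSemireg — the carrier bridge (2/3): the dictionary for an adapted basis — vacuum, exponential classes, point

HONEST FRAMING. Part of the Lean index of the computation cell `pub-hsemireg` (seat p3; Sunday enclosure of the
FORMULA-N kernel assets of seats th-7 / th-6, ENCLOSURE-PLAN-p3.md).  Finite-dimensional exterior algebra over a field ONLY:
no variety, no cohomology theory, no semiregularity map is constructed here; nothing here says that HC / HC_CM / HC_AV holds;
no Literature fact is declared or used.  The geometric DICTIONARY (why these ranks are the `HT`-side box ranks of the cell's
STRUCTURE.md §1 / theory/FORMULA-N.md) lives in theory/FORMULA-N-th7.md PART B §A.3 / §N and is NOT asserted in Lean.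

th-7's carrier bridge v2 (993195f303c63fcb) §4 DICTIONARY, part 1 (l.385–588), VERBATIM up to the namespace: for an ADAPTED
basis `bV : Basis (Fin (n+n)) K V` — `ℓ_a := bV (castAdd n a)` spanning `L := Lsp bV`, `m_a := bV (natAdd n a)`, `θ_a := bV.coord
(natAdd n a) ∈ Ann L` — the generators `x_a = (ℓ_a, 0)`, `y_a = (0, θ_a)` of `𝒜 = ⋀W`, the REVERSED vacuum `ω = m_{n−1} ∧ ⋯ ∧ m_0`
(this is what makes every step sign-free), the elementary even factors `E_k(λ) = 1 + λ ℓ_k ∧ m_k` and their products `Eprod`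
(`= exp(λΘ)`, `Θ = Σ ℓ_a ∧ m_a`), `gprod λ k = Π_{a<k} (y_a + λ x_a)` (HankelRank's generator pattern in `𝒜`), `yprod`, `xprod`,
`ellprod`, and the DICTIONARY theorems `Φ_gprod : Φ_ω (Π_a (y_a + λ x_a)) = Π_a (1 + λ ℓ_a ∧ m_a)` (EXACT, no sign), `Φ_yprod = 1`,
`Φ_xprod = (ℓ_0 ∧ ⋯ ∧ ℓ_{n−1}) ∧ ω`, `Φ_xprod_yprod`.  Generators pass the even θ-closed factors by p4's
`contractLeft_mul_of_mem_evenFactorAlg` / `commute_of_mem_evenFactorAlg` (`ContractionSpanFactor.lean`).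
-/

open Module
open CliffordAlgebra (contractLeft)
open ExteriorAlgebra (ι)

namespace Summit.Ventures.HSemireg.WedgeBridge

section Dictionary

open Summit.Ventures.HSemireg.ContractionSpan Set Set.powersetCard

variable {K : Type*} [Field K] {n : ℕ} {V : Type*} [AddCommGroup V] [Module K V] (bV : Basis (Fin (n + n)) K V)

/-- the «holomorphic» half `ℓ_a` of the adapted basis (spans `L`). -/
noncomputable def ℓ (a : Fin n) : V := bV (Fin.castAdd n a)
/-- the complementary half `m_a`. -/
noncomputable def m (a : Fin n) : V := bV (Fin.natAdd n a)
/-- the forms `θ_a` dual to the `m_a`, killing the `ℓ_b`. -/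
noncomputable def θ (a : Fin n) : Module.Dual K V := bV.coord (Fin.natAdd n a)
/-- `L = span{ℓ_a}`. -/
noncomputable def Lsp : Submodule K V := Submodule.span K (Set.range (ℓ bV))

/-- `θ_a (ℓ_b) = 0`: the forms kill the `ℓ`-block. -/
lemma θ_ℓ (a b : Fin n) : θ bV a (ℓ bV b) = 0 := by
  rw [θ, ℓ, Basis.coord_apply, Basis.repr_self, Finsupp.single_apply, if_neg]
  intro h
  have := congrArg Fin.val h
  simp at this
  omega

/-- `θ_a (m_b) = δ_{ab}`. -/
lemma θ_m (a b : Fin n) : θ bV a (m bV b) = if a = b then 1 else 0 := by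
  rw [θ, m, Basis.coord_apply, Basis.repr_self, Finsupp.single_apply]
  by_cases h : a = b
  · subst h; simp
  · rw [if_neg h, if_neg]
    intro h'
    apply h
    have := congrArg Fin.val h'
    simp only [Fin.val_natAdd] at this
    exact Fin.ext (by omega)

/-- `ℓ_a ∈ L`. -/
lemma ℓ_mem (a : Fin n) : ℓ bV a ∈ Lsp bV := Submodule.subset_span ⟨a, rfl⟩

/-- `θ_a ∈ Ann L`. -/
lemma θ_mem (a : Fin n) : θ bV a ∈ (Lsp bV).dualAnnihilator := by
  rw [Submodule.mem_dualAnnihilator]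
  intro w hw
  have : Lsp bV ≤ LinearMap.ker (θ bV a) := by
    rw [Lsp, Submodule.span_le]
    rintro _ ⟨b, rfl⟩
    exact θ_ℓ bV a b
  exact this hw

-- seal `Lsp` (its unfolding to `Submodule.span = sInf …` inside types makes `whnf` explode downstream)
attribute [irreducible] Lsp

/-- the generators `x_a = (ℓ_a, 0)` and `y_a = (0, θ_a)` of `𝒜 = Λ W`. -/
noncomputable def Xg (a : Fin n) : ExteriorAlgebra K (W K (Lsp bV)) := ι K (⟨ℓ bV a, ℓ_mem bV a⟩, 0)
/-- the generator `y_a = (0, θ_a)` of `𝒜 = Λ W`. -/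
noncomputable def Yg (a : Fin n) : ExteriorAlgebra K (W K (Lsp bV)) := ι K (0, ⟨θ bV a, θ_mem bV a⟩)

/-- `ρ(x_a)` is left multiplication by `ℓ_a`. -/
lemma ρ_Xg (a : Fin n) (z : ExteriorAlgebra K V) : ρ K (Lsp bV) (Xg bV a) z = ι K (ℓ bV a) * z := by
  rw [Xg, ρ_ι, op_apply]
  simp

/-- `ρ(y_a)` is the contraction `θ_a ⌟`. -/
lemma ρ_Yg (a : Fin n) (z : ExteriorAlgebra K V) : ρ K (Lsp bV) (Yg bV a) z = contractLeft (θ bV a) z := by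
  rw [Yg, ρ_ι, op_apply]
  simp

/-! ℕ-indexed versions (junk `0` beyond `n`) for the recursions. -/
/-- `m_k` with junk `0` for `k ≥ n`. -/
noncomputable def mN (k : ℕ) : V := if h : k < n then m bV ⟨k, h⟩ else 0
/-- `ℓ_k` with junk `0` for `k ≥ n`. -/
noncomputable def ℓN (k : ℕ) : V := if h : k < n then ℓ bV ⟨k, h⟩ else 0
/-- `θ_k` with junk `0` for `k ≥ n`. -/
noncomputable def θN (k : ℕ) : Module.Dual K V := if h : k < n then θ bV ⟨k, h⟩ else 0
/-- `x_k` with junk `0` for `k ≥ n`. -/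
noncomputable def XN (k : ℕ) : ExteriorAlgebra K (W K (Lsp bV)) := if h : k < n then Xg bV ⟨k, h⟩ else 0
/-- `y_k` with junk `0` for `k ≥ n`. -/
noncomputable def YN (k : ℕ) : ExteriorAlgebra K (W K (Lsp bV)) := if h : k < n then Yg bV ⟨k, h⟩ else 0

/-- the vacuum `ω_k = m_{k-1} ∧ ⋯ ∧ m_0` (REVERSED order: this is what makes every step sign-free). -/
noncomputable def vac : ℕ → ExteriorAlgebra K V
  | 0 => 1
  | k + 1 => ι K (mN bV k) * vac k

/-- the elementary even factor `E_k(λ) = 1 + λ · ℓ_k ∧ m_k`. -/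
noncomputable def Efac (lam : K) (k : ℕ) : ExteriorAlgebra K V := 1 + lam • (ι K (ℓN bV k) * ι K (mN bV k))

/-- `Eprod λ k = E_{k-1} ⋯ E_0` (= `exp(λ Σ_{a<k} ℓ_a ∧ m_a)`; the factors commute). -/
noncomputable def Eprod (lam : K) : ℕ → ExteriorAlgebra K V
  | 0 => 1
  | k + 1 => Efac bV lam k * Eprod lam k

/-- `gprod λ k = Π_{a<k} (y_a + λ x_a)` — th-6's `vClass` / HankelRank's `w` generator pattern in `𝒜`. -/
noncomputable def gprod (lam : K) : ℕ → ExteriorAlgebra K (W K (Lsp bV))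
  | 0 => 1
  | k + 1 => gprod lam k * (YN bV k + lam • XN bV k)

/-- `yprod k = y_0 ⋯ y_{k-1}`, `xprod k = x_0 ⋯ x_{k-1}`. -/
noncomputable def yprod : ℕ → ExteriorAlgebra K (W K (Lsp bV))
  | 0 => 1
  | k + 1 => yprod k * YN bV k
/-- `xprod k = x_0 ⋯ x_{k-1}`. -/
noncomputable def xprod : ℕ → ExteriorAlgebra K (W K (Lsp bV))
  | 0 => 1
  | k + 1 => xprod k * XN bV k
/-- `ellprod k = ℓ_0 ∧ ⋯ ∧ ℓ_{k-1}`. -/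
noncomputable def ellprod : ℕ → ExteriorAlgebra K V
  | 0 => 1
  | k + 1 => ellprod k * ι K (ℓN bV k)

/-- `θ_j` kills the vacuum `ω_k` for `j ≥ k`. -/
lemma contract_vac {j k : ℕ} (hj : j < n) (hkj : k ≤ j) : contractLeft (θN bV j) (vac bV k) = 0 := by
  induction k with
  | zero => rw [vac, CliffordAlgebra.contractLeft_one]
  | succ k ih =>
    have hk : k < n := by omega
    rw [vac, CliffordAlgebra.contractLeft_ι_mul, ih (by omega), mul_zero, sub_zero, θN, dif_pos hj, mN, dif_pos hk,
      θ_m, if_neg (by intro h; have := congrArg Fin.val h; simp at this; omega), zero_smul]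

/-- `θ_a` kills `E_k` for `a ≠ k`. -/
lemma contract_Efac {a k : ℕ} (ha : a < n) (hk : k < n) (hak : a ≠ k) (lam : K) :
    contractLeft (θN bV a) (Efac bV lam k) = 0 := by
  rw [Efac, map_add, CliffordAlgebra.contractLeft_one, map_smul, CliffordAlgebra.contractLeft_ι_mul,
    CliffordAlgebra.contractLeft_ι, θN, dif_pos ha, ℓN, dif_pos hk, mN, dif_pos hk, θ_ℓ, zero_smul, zero_sub,
    θ_m, if_neg (by intro h; have := congrArg Fin.val h; simp at this; omega), map_zero, mul_zero, neg_zero,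
    smul_zero, add_zero]

/-- the elementary factor `E_k(λ)` lies in the even part of the exterior algebra. -/
lemma Efac_mem (lam : K) (k : ℕ) : Efac bV lam k ∈ evenFactorAlg (K := K) (⊤ : Submodule K V) := by
  refine Subalgebra.add_mem _ (Subalgebra.one_mem _) (Subalgebra.smul_mem _ ?_ _)
  exact ι_mul_ι_mem_evenFactorAlg Submodule.mem_top Submodule.mem_top

/-- one generator `y_a + λ x_a` passes an even, `θ_a`-closed factor. -/
lemma ρg_Efac {a k : ℕ} (ha : a < n) (hk : k < n) (hak : a ≠ k) (lam mu : K) (z : ExteriorAlgebra K V) :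
    ρ K (Lsp bV) (YN bV a + mu • XN bV a) (Efac bV lam k * z) =
      Efac bV lam k * ρ K (Lsp bV) (YN bV a + mu • XN bV a) z := by
  have hE := Efac_mem bV lam k
  rw [map_add, map_smul, LinearMap.add_apply, LinearMap.smul_apply, LinearMap.add_apply, LinearMap.smul_apply,
    YN, dif_pos ha, XN, dif_pos ha, ρ_Yg, ρ_Xg, ρ_Yg, ρ_Xg,
    contractLeft_mul_of_mem_evenFactorAlg _ hE, ← θN_def, contract_Efac bV ha hk hak, zero_mul, zero_add,
    ← mul_assoc, ← (commute_of_mem_evenFactorAlg hE (ι K (ℓ bV ⟨a, ha⟩))).eq, mul_assoc, mul_add, mul_smul_comm]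
where
  θN_def : θN bV a = θ bV ⟨a, ha⟩ := by rw [θN, dif_pos ha]

/-- the whole product `Π_{b<k} (y_b + λ x_b)` passes `E_j` for `j ≥ k`. -/
lemma ρgprod_Efac (lam : K) {j : ℕ} (hj : j < n) :
    ∀ {k : ℕ}, k ≤ j → ∀ z, ρ K (Lsp bV) (gprod bV lam k) (Efac bV lam j * z) =
      Efac bV lam j * ρ K (Lsp bV) (gprod bV lam k) z := by
  intro k
  induction k with
  | zero => intro _ z; rw [gprod, map_one (ρ K (Lsp bV)), Module.End.one_apply, Module.End.one_apply]
  | succ k ih =>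
    intro hk z
    rw [gprod, map_mul (ρ K (Lsp bV)), Module.End.mul_apply, Module.End.mul_apply, ρg_Efac bV (by omega) hj (by omega),
      ih (by omega)]

/-- **LEMMA A (sign-free peeling):** `ρ(Π_{a<k}(y_a + λ x_a)) (m_{k-1} ∧ ⋯ ∧ m_0) = E_{k-1}(λ) ⋯ E_0(λ)`. -/
theorem ρ_gprod_vac (lam : K) : ∀ {k : ℕ}, k ≤ n → ρ K (Lsp bV) (gprod bV lam k) (vac bV k) = Eprod bV lam k := by
  intro k
  induction k with
  | zero => intro _; rw [gprod, vac, Eprod, map_one (ρ K (Lsp bV)), Module.End.one_apply]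
  | succ k ih =>
    intro hk
    have hk' : k < n := by omega
    have step : ρ K (Lsp bV) (YN bV k + lam • XN bV k) (vac bV (k + 1)) = Efac bV lam k * vac bV k := by
      rw [map_add, map_smul, LinearMap.add_apply, LinearMap.smul_apply, YN, dif_pos hk', XN, dif_pos hk', ρ_Yg,
        ρ_Xg, vac, CliffordAlgebra.contractLeft_ι_mul]
      have h1 : θ bV ⟨k, hk'⟩ (mN bV k) = 1 := by rw [mN, dif_pos hk', θ_m, if_pos rfl]
      have h2 : contractLeft (θ bV ⟨k, hk'⟩) (vac bV k) = 0 := by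
        have := contract_vac bV hk' (le_refl k); rwa [θN, dif_pos hk'] at this
      rw [h1, one_smul, h2, mul_zero, sub_zero, Efac, add_mul, one_mul, smul_mul_assoc, ℓN, dif_pos hk',
        mul_assoc]
    rw [gprod, map_mul (ρ K (Lsp bV)), Module.End.mul_apply, step, ρgprod_Efac bV lam hk' (le_refl k), ih (by omega), Eprod]

/-- **LEMMA B:** `ρ(y_0 ⋯ y_{k-1}) (m_{k-1} ∧ ⋯ ∧ m_0) = 1`. -/
theorem ρ_yprod_vac : ∀ {k : ℕ}, k ≤ n → ρ K (Lsp bV) (yprod bV k) (vac bV k) = 1 := by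
  intro k
  induction k with
  | zero => intro _; rw [yprod, vac, map_one (ρ K (Lsp bV)), Module.End.one_apply]
  | succ k ih =>
    intro hk
    have hk' : k < n := by omega
    have h1 : θ bV ⟨k, hk'⟩ (mN bV k) = 1 := by rw [mN, dif_pos hk', θ_m, if_pos rfl]
    have h2 : contractLeft (θ bV ⟨k, hk'⟩) (vac bV k) = 0 := by
      have := contract_vac bV hk' (le_refl k); rwa [θN, dif_pos hk'] at this
    rw [yprod, vac, map_mul (ρ K (Lsp bV)), Module.End.mul_apply, YN, dif_pos hk', ρ_Yg, CliffordAlgebra.contractLeft_ι_mul, h1,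
      one_smul, h2, mul_zero, sub_zero, ih (by omega)]

/-- `ρ(x_0 ⋯ x_{k-1}) z = (ℓ_0 ∧ ⋯ ∧ ℓ_{k-1}) ∧ z`. -/
theorem ρ_xprod : ∀ {k : ℕ}, k ≤ n → ∀ z, ρ K (Lsp bV) (xprod bV k) z = ellprod bV k * z := by
  intro k
  induction k with
  | zero => intro _ z; rw [xprod, ellprod, map_one (ρ K (Lsp bV)), Module.End.one_apply, one_mul]
  | succ k ih =>
    intro hk z
    have hk' : k < n := by omega
    rw [xprod, ellprod, map_mul (ρ K (Lsp bV)), Module.End.mul_apply, XN, dif_pos hk', ρ_Xg, ih (by omega), ℓN, dif_pos hk',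
      mul_assoc]

/-- the vacuum of record `ω = m_{n-1} ∧ ⋯ ∧ m_0`. -/
noncomputable def vacuum : ExteriorAlgebra K V := vac bV n

/-- **DICTIONARY (exponential classes):** `Φ_ω(Π_a (y_a + λ x_a)) = Π_a (1 + λ ℓ_a ∧ m_a)` — EXACT, no sign. -/
theorem Φ_gprod (lam : K) : Φ K (Lsp bV) (vacuum bV) (gprod bV lam n) = Eprod bV lam n :=
  ρ_gprod_vac bV lam (le_refl n)

/-- **DICTIONARY (unit):** `Φ_ω(y_0 ⋯ y_{n-1}) = 1`. -/
theorem Φ_yprod : Φ K (Lsp bV) (vacuum bV) (yprod bV n) = 1 := ρ_yprod_vac bV (le_refl n)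

/-- **DICTIONARY (point):** `Φ_ω(x_0 ⋯ x_{n-1}) = (ℓ_0 ∧ ⋯ ∧ ℓ_{n-1}) ∧ ω` (a top form of `V`). -/
theorem Φ_xprod : Φ K (Lsp bV) (vacuum bV) (xprod bV n) = ellprod bV n * vacuum bV :=
  ρ_xprod bV (le_refl n) _

/-- `Φ_ω(x_0 ⋯ x_{n-1} · y_0 ⋯ y_{n-1}) = ℓ_0 ∧ ⋯ ∧ ℓ_{n-1}`. -/
theorem Φ_xprod_yprod : Φ K (Lsp bV) (vacuum bV) (xprod bV n * yprod bV n) = ellprod bV n := by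
  rw [Φ_mul, Φ_yprod, ρ_xprod bV (le_refl n), mul_one]

/-! #### Injectivity of `Φ_ω` for the adapted vacuum: `ℓ_0 ∧ ⋯ ∧ ℓ_{n-1} ≠ 0`, the top monomial, one-dimensionality of `Λ^{2n} W` -/

end Dictionary

end Summit.Ventures.HSemireg.WedgeBridge
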